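import Literature.Computability.QuantumComplexity.RevSLPExact
import HarnessLib

/-!
# Reversible arithmetic gadgets, V: compiling arithmetic and Boolean expressions to straight-line programs

Topic `Literature/Computability/QuantumComplexity`; sequel of `RevSLPExact.lean`. A tiny expression
language — arithmetic expressions `AExpr` (input fields, powers of two, shifted sums, products) and
Boolean expressions `BExpr` (comparisons `<`, `¬`, `∧`, `∨`) — compiled to straight-line register
programs (`RevSLP.lean`) by a linear register/flag allocator, with the correctness theorems for the
*exact* interpreter: `AExpr.runExact_compile` (the result register holds `AExpr.eval`, lower registers
are unchanged, every register written is bounded by `AExpr.maxBnd`, higher registers stay clear, flags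
untouched) and `BExpr.runExact_compile` (the result flag holds `BExpr.eval`). Together with
`SLP.run_eq_runExact` and `SLP.clEval_compile` this turns an integer polynomial inequality into a
verified `NOT`/`CNOT`/Toffoli program computing its truth value into a flag wire; the shape/freshness
side conditions of `SLP.ProgWF` are discharged once and for all (`AExpr.progWF_compile`,
`BExpr.progWF_compile`).

## References

* V. Vedral, A. Barenco, A. Ekert, Phys. Rev. A 54 (1996), §3 [VedralBarencoEkert1996].
* M. A. Nielsen, I. L. Chuang, *Quantum Computation and Quantum Information*, CUP 2010, §3.2.5
  [NielsenChuang2010].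
-/

namespace Literature.Computability.QuantumComplexity

namespace SLP

open Function

/-! ### Syntax and semantics -/

/-- Arithmetic expressions over the input fields. [folklore] -/
inductive AExpr
  /-- the input field of `len` bits at offset `off` -/
  | fld (off len : ℕ)
  /-- the constant `2^i` -/
  | pw (i : ℕ)
  /-- `e₁ + e₂ · 2^sh` -/
  | add (e₁ e₂ : AExpr) (sh : ℕ)
  /-- `e₁ · e₂` -/
  | mul (e₁ e₂ : AExpr)

/-- Boolean expressions: comparisons and connectives. [folklore] -/
inductive BExpr
  /-- `e₁ < e₂` -/
  | lt (e₁ e₂ : AExpr)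
  /-- negation -/
  | not (b : BExpr)
  /-- conjunction -/
  | and (b₁ b₂ : BExpr)
  /-- disjunction -/
  | or (b₁ b₂ : BExpr)

variable (inp : ℕ)

/-- The value of an arithmetic expression. [folklore] -/
def AExpr.eval : AExpr → ℕ
  | .fld off len => inp / 2 ^ off % 2 ^ len
  | .pw i => 2 ^ i
  | .add e₁ e₂ sh => e₁.eval + e₂.eval * 2 ^ sh
  | .mul e₁ e₂ => e₁.eval * e₂.eval

/-- The value of a Boolean expression. [folklore] -/
def BExpr.eval : BExpr → Bool
  | .lt e₁ e₂ => decide (e₁.eval inp < e₂.eval inp)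
  | .not b => !b.eval
  | .and b₁ b₂ => b₁.eval && b₂.eval
  | .or b₁ b₂ => b₁.eval || b₂.eval

/-- A bound on the value of an expression valid for every input (fields bounded by `2^{len}`).
[folklore] -/
def AExpr.bnd : AExpr → ℕ
  | .fld _ len => 2 ^ len
  | .pw i => 2 ^ i
  | .add e₁ e₂ sh => e₁.bnd + e₂.bnd * 2 ^ sh
  | .mul e₁ e₂ => e₁.bnd * e₂.bnd

/-- A bound on every intermediate value of the compiled program (all sub-expressions). [folklore] -/
def AExpr.maxBnd : AExpr → ℕ
  | .fld off len => (AExpr.fld off len).bnd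
  | .pw i => (AExpr.pw i).bnd
  | .add e₁ e₂ sh => max ((AExpr.add e₁ e₂ sh).bnd) (max e₁.maxBnd e₂.maxBnd)
  | .mul e₁ e₂ => max ((AExpr.mul e₁ e₂).bnd) (max e₁.maxBnd e₂.maxBnd)

/-- The same for Boolean expressions. [folklore] -/
def BExpr.maxBnd : BExpr → ℕ
  | .lt e₁ e₂ => max e₁.maxBnd e₂.maxBnd
  | .not b => b.maxBnd
  | .and b₁ b₂ => max b₁.maxBnd b₂.maxBnd
  | .or b₁ b₂ => max b₁.maxBnd b₂.maxBnd

/-- Values are below the bound. [folklore] -/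
theorem AExpr.eval_le_bnd : ∀ e : AExpr, e.eval inp ≤ e.bnd
  | .fld _ len => (Nat.mod_lt _ (Nat.two_pow_pos len)).le
  | .pw _ => le_rfl
  | .add e₁ e₂ _ => Nat.add_le_add (e₁.eval_le_bnd) (Nat.mul_le_mul_right _ e₂.eval_le_bnd)
  | .mul e₁ e₂ => Nat.mul_le_mul e₁.eval_le_bnd e₂.eval_le_bnd

/-- The bound of an expression is below its intermediate bound. [folklore] -/
theorem AExpr.bnd_le_maxBnd : ∀ e : AExpr, e.bnd ≤ e.maxBnd
  | .fld _ _ => le_rfl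
  | .pw _ => le_rfl
  | .add _ _ _ => le_max_left _ _
  | .mul _ _ => le_max_left _ _

/-! ### The compiler -/

/-- **Compiling an arithmetic expression** with the registers from `r` on free: returns the
program, the result register and the next free register. [cite: VedralBarencoEkert1996, §3.3] -/
def AExpr.compile (Wd : ℕ) : AExpr → ℕ → List Instr × ℕ × ℕ
  | .fld off len, r => ([.copyIn r off len], r, r + 1)
  | .pw i, r => ([.setBit r i], r, r + 1)
  | .add e₁ e₂ sh, r =>
    let c₁ := e₁.compile Wd r
    let c₂ := e₂.compile Wd c₁.2.2
    (c₁.1 ++ c₂.1 ++ [.add c₂.2.2 c₁.2.1 c₂.2.1 sh], c₂.2.2, c₂.2.2 + 1)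
  | .mul e₁ e₂, r =>
    let c₁ := e₁.compile Wd r
    let c₂ := e₂.compile Wd c₁.2.2
    (c₁.1 ++ c₂.1 ++ mulInstrs Wd c₂.2.2 c₁.2.1 c₂.2.1, c₂.2.2 + 2 * Wd, c₂.2.2 + 2 * Wd + 1)

/-- **Compiling a Boolean expression** with registers from `r` and flags from `φ` on free: returns
the program, the result flag, the next free register and the next free flag. [folklore] -/
def BExpr.compile (Wd : ℕ) : BExpr → ℕ → ℕ → List Instr × ℕ × ℕ × ℕ
  | .lt e₁ e₂, r, φ =>
    let c₁ := e₁.compile Wd r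
    let c₂ := e₂.compile Wd c₁.2.2
    (c₁.1 ++ c₂.1 ++ [.lt φ c₁.2.1 c₂.2.1], φ, c₂.2.2, φ + 1)
  | .not b, r, φ =>
    let c := b.compile Wd r φ
    (c.1 ++ [.fnot c.2.2.2 c.2.1], c.2.2.2, c.2.2.1, c.2.2.2 + 1)
  | .and b₁ b₂, r, φ =>
    let c₁ := b₁.compile Wd r φ
    let c₂ := b₂.compile Wd c₁.2.2.1 c₁.2.2.2
    (c₁.1 ++ c₂.1 ++ [.fand c₂.2.2.2 c₁.2.1 c₂.2.1], c₂.2.2.2, c₂.2.2.1, c₂.2.2.2 + 1)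
  | .or b₁ b₂, r, φ =>
    let c₁ := b₁.compile Wd r φ
    let c₂ := b₂.compile Wd c₁.2.2.1 c₁.2.2.2
    (c₁.1 ++ c₂.1 ++ [.forr c₂.2.2.2 c₁.2.1 c₂.2.1], c₂.2.2.2, c₂.2.2.1, c₂.2.2.2 + 1)

variable {inp}
variable (Wd : ℕ)

/-- The allocator only moves up: `r ≤ result < next`. [folklore] -/
theorem AExpr.compile_bounds : ∀ (e : AExpr) (r : ℕ), r ≤ (e.compile Wd r).2.1 ∧ (e.compile Wd r).2.1 < (e.compile Wd r).2.2
  | .fld _ _, r => ⟨le_rfl, Nat.lt_succ_self r⟩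
  | .pw _, r => ⟨le_rfl, Nat.lt_succ_self r⟩
  | .add e₁ e₂ sh, r => by
    have h1 := e₁.compile_bounds r; have h2 := e₂.compile_bounds (e₁.compile Wd r).2.2
    simp only [AExpr.compile]; omega
  | .mul e₁ e₂, r => by
    have h1 := e₁.compile_bounds r; have h2 := e₂.compile_bounds (e₁.compile Wd r).2.2
    simp only [AExpr.compile]; omega

/-- **Registers written by a compiled expression**: all in `[r, next)`. [folklore] -/
theorem AExpr.mem_rdest_compile : ∀ (e : AExpr) (r d : ℕ), d ∈ (e.compile Wd r).1.filterMap Instr.rdest → r ≤ d ∧ d < (e.compile Wd r).2.2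
  | .fld _ _, r, d, h => by simp [AExpr.compile, Instr.rdest] at h ⊢; omega
  | .pw _, r, d, h => by simp [AExpr.compile, Instr.rdest] at h ⊢; omega
  | .add e₁ e₂ sh, r, d, h => by
    have b1 := e₁.compile_bounds Wd r; have b2 := e₂.compile_bounds Wd (e₁.compile Wd r).2.2
    simp only [AExpr.compile, List.filterMap_append, List.mem_append] at h ⊢
    rcases h with (h | h) | h
    · have := e₁.mem_rdest_compile r d h; omega
    · have := e₂.mem_rdest_compile _ d h; omega
    · simp [Instr.rdest] at h; omega
  | .mul e₁ e₂, r, d, h => by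
    have b1 := e₁.compile_bounds Wd r; have b2 := e₂.compile_bounds Wd (e₁.compile Wd r).2.2
    simp only [AExpr.compile, List.filterMap_append, List.mem_append] at h ⊢
    rcases h with (h | h) | h
    · have := e₁.mem_rdest_compile r d h; omega
    · have := e₂.mem_rdest_compile _ d h; omega
    · rw [mulInstrs, mem_filterMap_rdest_mulInstrsUpTo] at h; obtain ⟨j, h1, h2, rfl⟩ := h; omega

/-- Compiled arithmetic expressions write no flag. [folklore] -/
theorem AExpr.filterMap_fdest_compile : ∀ (e : AExpr) (r : ℕ), (e.compile Wd r).1.filterMap Instr.fdest = []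
  | .fld _ _, r => rfl
  | .pw _, r => rfl
  | .add e₁ e₂ sh, r => by
    simp only [AExpr.compile, List.filterMap_append, e₁.filterMap_fdest_compile, e₂.filterMap_fdest_compile]; rfl
  | .mul e₁ e₂, r => by
    simp only [AExpr.compile, List.filterMap_append, e₁.filterMap_fdest_compile, e₂.filterMap_fdest_compile, mulInstrs,
      filterMap_fdest_mulInstrsUpTo]; rfl

/-- The register destinations of a compiled expression are pairwise distinct. [folklore] -/
theorem AExpr.nodup_rdest_compile : ∀ (e : AExpr) (r : ℕ), ((e.compile Wd r).1.filterMap Instr.rdest).Nodup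
  | .fld _ _, r => by simp [AExpr.compile, Instr.rdest]
  | .pw _, r => by simp [AExpr.compile, Instr.rdest]
  | .add e₁ e₂ sh, r => by
    have b1 := e₁.compile_bounds Wd r; have b2 := e₂.compile_bounds Wd (e₁.compile Wd r).2.2
    simp only [AExpr.compile, List.filterMap_append]
    refine List.Nodup.append (List.Nodup.append (e₁.nodup_rdest_compile r) (e₂.nodup_rdest_compile _) ?_) (by simp [Instr.rdest]) ?_
    · intro d h1 h2; have := e₁.mem_rdest_compile Wd r d h1; have := e₂.mem_rdest_compile Wd _ d h2; omega
    · intro d h1 h2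
      simp [Instr.rdest] at h2
      rw [List.mem_append] at h1
      rcases h1 with h1 | h1
      · have := e₁.mem_rdest_compile Wd r d h1; omega
      · have := e₂.mem_rdest_compile Wd _ d h1; omega
  | .mul e₁ e₂, r => by
    have b1 := e₁.compile_bounds Wd r; have b2 := e₂.compile_bounds Wd (e₁.compile Wd r).2.2
    simp only [AExpr.compile, List.filterMap_append]
    refine List.Nodup.append (List.Nodup.append (e₁.nodup_rdest_compile r) (e₂.nodup_rdest_compile _) ?_)
      (by rw [mulInstrs]; exact nodup_filterMap_rdest_mulInstrsUpTo _ _ _ _) ?_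
    · intro d h1 h2; have := e₁.mem_rdest_compile Wd r d h1; have := e₂.mem_rdest_compile Wd _ d h2; omega
    · intro d h1 h2
      rw [mulInstrs, mem_filterMap_rdest_mulInstrsUpTo] at h2
      obtain ⟨j, hj1, hj2, rfl⟩ := h2
      rw [List.mem_append] at h1
      rcases h1 with h1 | h1
      · have := e₁.mem_rdest_compile Wd r _ h1; omega
      · have := e₂.mem_rdest_compile Wd _ _ h1; omega

/-- **Shapes of a compiled arithmetic expression**, provided its fields fit the input, its powers of
two and shifts are arbitrary (`setBit` needs `i < Wd`, recorded in `AExpr.OK`), and the registers used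
stay below `R`. [folklore] -/
def AExpr.OK (Wd kIn : ℕ) : AExpr → Prop
  | .fld off len => off + len ≤ kIn ∧ len ≤ Wd
  | .pw i => i < Wd
  | .add e₁ e₂ _ => e₁.OK Wd kIn ∧ e₂.OK Wd kIn
  | .mul e₁ e₂ => e₁.OK Wd kIn ∧ e₂.OK Wd kIn

/-- Shapes of the instructions of a compiled expression. [folklore] -/
theorem AExpr.shape_compile {kIn R F : ℕ} : ∀ (e : AExpr) (r : ℕ), e.OK Wd kIn → (e.compile Wd r).2.2 ≤ R →
    ∀ ins ∈ (e.compile Wd r).1, ins.Shape Wd kIn R F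
  | .fld off len, r, hok, hR, ins, h => by
    simp [AExpr.compile] at h; subst h; simp only [AExpr.compile] at hR; exact ⟨by omega, hok.1, hok.2⟩
  | .pw i, r, _, hR, ins, h => by simp [AExpr.compile] at h; subst h; simp only [AExpr.compile] at hR; show r < R; omega
  | .add e₁ e₂ sh, r, hok, hR, ins, h => by
    have b1 := e₁.compile_bounds Wd r; have b2 := e₂.compile_bounds Wd (e₁.compile Wd r).2.2
    simp only [AExpr.compile] at hR h
    rw [List.mem_append, List.mem_append] at h
    rcases h with (h | h) | h
    · exact e₁.shape_compile r hok.1 (by omega) ins h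
    · exact e₂.shape_compile _ hok.2 (by omega) ins h
    · simp at h; subst h; exact ⟨by omega, by omega, by omega, by omega, by omega, by omega⟩
  | .mul e₁ e₂, r, hok, hR, ins, h => by
    have b1 := e₁.compile_bounds Wd r; have b2 := e₂.compile_bounds Wd (e₁.compile Wd r).2.2
    simp only [AExpr.compile] at hR h
    rw [List.mem_append, List.mem_append] at h
    rcases h with (h | h) | h
    · exact e₁.shape_compile r hok.1 (by omega) ins h
    · exact e₂.shape_compile _ hok.2 (by omega) ins h
    · rw [mulInstrs] at h
      exact shape_of_mem_mulInstrsUpTo (by omega) (by omega) (by omega) Wd le_rfl (by omega) ins h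

/-- `setBit` in a compiled `OK` expression only with `i < Wd`. [folklore] -/
theorem AExpr.setBit_lt_of_mem_compile {kIn : ℕ} : ∀ (e : AExpr) (r : ℕ), e.OK Wd kIn →
    ∀ ins ∈ (e.compile Wd r).1, ∀ d i, ins = .setBit d i → i < Wd
  | .fld off len, r, _, ins, h, d, i, e => by simp [AExpr.compile] at h; subst h; cases e
  | .pw i', r, hok, ins, h, d, i, e => by simp [AExpr.compile] at h; subst h; cases e; exact hok
  | .add e₁ e₂ sh, r, hok, ins, h, d, i, e => by
    simp only [AExpr.compile, List.mem_append] at h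
    rcases h with (h | h) | h
    · exact e₁.setBit_lt_of_mem_compile r hok.1 ins h d i e
    · exact e₂.setBit_lt_of_mem_compile _ hok.2 ins h d i e
    · simp at h; subst h; cases e
  | .mul e₁ e₂, r, hok, ins, h, d, i, e => by
    simp only [AExpr.compile, List.mem_append] at h
    rcases h with (h | h) | h
    · exact e₁.setBit_lt_of_mem_compile r hok.1 ins h d i e
    · exact e₂.setBit_lt_of_mem_compile _ hok.2 ins h d i e
    · rw [mulInstrs] at h
      exact absurd e (ne_setBit_of_mem_mulInstrsUpTo _ _ _ _ ins h d i)

/-! ### Bounded exact runs -/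

section Bdd

variable (inp : ℕ)

/-- Every prefix of the exact run of `p` from `st` keeps all registers `≤ B`. [folklore] -/
def BddRun (B : ℕ) (st : State) (p : List Instr) : Prop :=
  ∀ p₁ p₂, p = p₁ ++ p₂ → ∀ ρ, (runExact inp st p₁).regs ρ ≤ B

variable {inp}

/-- `BddRun` of the empty program is boundedness of the state. [folklore] -/
theorem bddRun_nil {B : ℕ} {st : State} (h : ∀ ρ, st.regs ρ ≤ B) : BddRun inp B st [] := by
  intro p₁ p₂ e ρ
  have : p₁ = [] := List.eq_nil_of_append_eq_nil' e |>.1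
  subst this; exact h ρ
where
  /-- helper: if `[] = p₁ ++ p₂` then both are empty -/
  List.eq_nil_of_append_eq_nil' {α : Type} {p₁ p₂ : List α} (e : ([] : List α) = p₁ ++ p₂) : p₁ = [] ∧ p₂ = [] :=
    List.append_eq_nil_iff.1 e.symm

/-- `BddRun` along a concatenation. [folklore] -/
theorem bddRun_append {B : ℕ} {st : State} {p q : List Instr} (hp : BddRun inp B st p) (hq : BddRun inp B (runExact inp st p) q) :
    BddRun inp B st (p ++ q) := by
  intro p₁ p₂ e ρ
  rcases List.append_eq_append_iff.1 e with ⟨a', h1, h2⟩ | ⟨c', h1, h2⟩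
  · -- `p₁ = p ++ a'`, `q = a' ++ p₂`
    rw [h1, runExact_append]; exact hq a' p₂ h2 ρ
  · -- `p = p₁ ++ c'`
    exact hp p₁ c' h1 ρ

/-- The state reached by a bounded run is bounded. [folklore] -/
theorem BddRun.final {B : ℕ} {st : State} {p : List Instr} (hp : BddRun inp B st p) : ∀ ρ, (runExact inp st p).regs ρ ≤ B :=
  hp p [] (by simp)

/-- A single register-writing step is bounded when the state and the written value are. [folklore] -/
theorem bddRun_single {B : ℕ} {st : State} (hst : ∀ ρ, st.regs ρ ≤ B) (ins : Instr)
    (hins : ∀ ρ, (stepExact inp st ins).regs ρ ≤ B) : BddRun inp B st [ins] := by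
  intro p₁ p₂ e ρ
  rcases p₁ with _ | ⟨i, p₁⟩
  · exact hst ρ
  · simp only [List.cons_append, List.cons.injEq] at e
    obtain ⟨rfl, e⟩ := e
    have : p₁ = [] := (List.append_eq_nil_iff.1 e.symm).1
    subst this; exact hins ρ

/-- A single step is bounded when the state is and it writes a bounded value into a register.
[folklore] -/
theorem bddRun_single_regs {B : ℕ} {st : State} (hst : ∀ ρ, st.regs ρ ≤ B) {d v : ℕ} (hv : v ≤ B) (ins : Instr)
    (hins : (stepExact inp st ins).regs = update st.regs d v) : BddRun inp B st [ins] :=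
  bddRun_single hst ins fun ρ => by rw [hins, update_apply]; split_ifs; exacts [hv, hst ρ]

/-- Bound of an updated register file. [folklore] -/
theorem regs_update_le {B : ℕ} {f : ℕ → ℕ} (hf : ∀ ρ, f ρ ≤ B) {d v : ℕ} (hv : v ≤ B) : ∀ ρ, update f d v ρ ≤ B := by
  intro ρ; rw [update_apply]; split_ifs; exacts [hv, hf ρ]

/-- **The multiplication macro runs boundedly** (every value it writes is `≤ x·y`). [folklore] -/
theorem bddRun_mulInstrsUpTo (Wd : ℕ) {B r₀ x y : ℕ} (hx : x < r₀) (hy : y < r₀) (st : State) (hst : ∀ ρ, st.regs ρ ≤ B)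
    (hblock : ∀ j, j ≤ 2 * Wd → st.regs (r₀ + j) = 0) (hB : st.regs x * st.regs y ≤ B) :
    ∀ i, i ≤ Wd → BddRun inp B st (mulInstrsUpTo r₀ x y i)
  | 0, _ => by simpa [mulInstrsUpTo] using bddRun_nil (inp := inp) hst
  | i + 1, hi => by
    rw [mulInstrsUpTo]
    refine bddRun_append (bddRun_mulInstrsUpTo Wd hx hy st hst hblock hB i (by omega)) ?_
    obtain ⟨hacc, _, hlow, _, hle, _⟩ := runExact_mulInstrsUpTo inp Wd hx hy st hblock i (by omega)
    set st₁ := runExact inp st (mulInstrsUpTo r₀ x y i)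
    have hst₁ : ∀ ρ, st₁.regs ρ ≤ B := (bddRun_mulInstrsUpTo Wd hx hy st hst hblock hB i (by omega)).final
    have hxv : st₁.regs x = st.regs x := hlow x hx
    have hyv : st₁.regs y = st.regs y := hlow y hy
    have hV : (if (st₁.regs x).testBit i then st₁.regs y else 0) ≤ B := by
      rw [hxv, hyv]; split_ifs with ht
      · have hx0 : 0 < st.regs x := Nat.pos_of_ne_zero fun h0 => by rw [h0, Nat.zero_testBit] at ht; exact Bool.false_ne_true ht
        exact (Nat.le_mul_of_pos_left _ hx0).trans hB
      · exact Nat.zero_le _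
    rw [show [Instr.andBit (r₀ + 2 * i + 1) x i y, .add (r₀ + 2 * i + 2) (r₀ + 2 * i) (r₀ + 2 * i + 1) i] =
      [Instr.andBit (r₀ + 2 * i + 1) x i y] ++ [.add (r₀ + 2 * i + 2) (r₀ + 2 * i) (r₀ + 2 * i + 1) i] from rfl]
    refine bddRun_append (bddRun_single hst₁ _ (regs_update_le hst₁ hV)) (bddRun_single (regs_update_le hst₁ hV) _ ?_)
    refine regs_update_le (regs_update_le hst₁ hV) ?_
    show update st₁.regs (r₀ + 2 * i + 1) _ (r₀ + 2 * i) + update st₁.regs (r₀ + 2 * i + 1) _ (r₀ + 2 * i + 1) * 2 ^ i ≤ B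
    rw [update_of_ne (by omega), update_self, hacc, hxv, hyv, mul_mod_two_pow_succ]
    exact (Nat.mul_le_mul_left _ (Nat.mod_le _ _)).trans (by rw [mul_comm]; exact hB)

end Bdd

/-! ### Correctness of the expression compiler (exact semantics) -/

section Correct

variable (inp Wd : ℕ)

/-- **Correctness of `AExpr.compile`** (exact interpreter): from a state whose registers from `r` on
are clear, the compiled program puts `e.eval` into the result register, leaves the registers below
`r` and all flags unchanged, keeps the registers from the next free one on clear, and — if the state
and `e.maxBnd` are bounded by `B` — runs boundedly. [cite: VedralBarencoEkert1996, §3.3] -/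
theorem AExpr.runExact_compile : ∀ (e : AExpr) (r : ℕ) (st : State), (∀ ρ, r ≤ ρ → st.regs ρ = 0) → e.maxBnd < 2 ^ Wd →
    let c := e.compile Wd r
    (runExact inp st c.1).regs c.2.1 = e.eval inp ∧
    (∀ ρ, ρ < r → (runExact inp st c.1).regs ρ = st.regs ρ) ∧
    (∀ ρ, c.2.2 ≤ ρ → (runExact inp st c.1).regs ρ = 0) ∧
    (runExact inp st c.1).flags = st.flags ∧
    (∀ B, (∀ ρ, st.regs ρ ≤ B) → e.maxBnd ≤ B → BddRun inp B st c.1)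
  | .fld off len, r, st, hfree, _ => by
    refine ⟨?_, fun ρ hρ => ?_, fun ρ hρ => ?_, rfl, fun B hB hmax => ?_⟩
    · show update st.regs r (inp / 2 ^ off % 2 ^ len) r = inp / 2 ^ off % 2 ^ len; exact update_self ..
    · show update st.regs r (inp / 2 ^ off % 2 ^ len) ρ = st.regs ρ; exact update_of_ne (by omega) ..
    · show update st.regs r (inp / 2 ^ off % 2 ^ len) ρ = 0
      rw [update_of_ne (show ρ ≠ r by simp only [AExpr.compile] at hρ; omega)]
      exact hfree ρ (by simp only [AExpr.compile] at hρ; omega)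
    · exact bddRun_single_regs hB ((Nat.mod_lt _ (Nat.two_pow_pos _)).le.trans hmax) (.copyIn r off len) rfl
  | .pw i, r, st, hfree, _ => by
    refine ⟨?_, fun ρ hρ => ?_, fun ρ hρ => ?_, rfl, fun B hB hmax => ?_⟩
    · show update st.regs r (2 ^ i) r = 2 ^ i; exact update_self ..
    · show update st.regs r (2 ^ i) ρ = st.regs ρ; exact update_of_ne (by omega) ..
    · show update st.regs r (2 ^ i) ρ = 0
      rw [update_of_ne (show ρ ≠ r by simp only [AExpr.compile] at hρ; omega)]
      exact hfree ρ (by simp only [AExpr.compile] at hρ; omega)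
    · exact bddRun_single_regs hB hmax (.setBit r i) rfl
  | .add e₁ e₂ sh, r, st, hfree, hmax => by
    have b1 := e₁.compile_bounds Wd r; have b2 := e₂.compile_bounds Wd (e₁.compile Wd r).2.2
    have hm1 : e₁.maxBnd < 2 ^ Wd := lt_of_le_of_lt (le_max_left _ _ |>.trans (le_max_right _ _)) hmax
    have hm2 : e₂.maxBnd < 2 ^ Wd := lt_of_le_of_lt (le_max_right _ _ |>.trans (le_max_right _ _)) hmax
    obtain ⟨v1, l1, f1, g1, bd1⟩ := e₁.runExact_compile r st hfree hm1
    set st₁ := runExact inp st (e₁.compile Wd r).1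
    obtain ⟨v2, l2, f2, g2, bd2⟩ := e₂.runExact_compile (e₁.compile Wd r).2.2 st₁ f1 hm2
    set st₂ := runExact inp st₁ (e₂.compile Wd (e₁.compile Wd r).2.2).1
    simp only [AExpr.compile]
    rw [runExact_append, runExact_append]
    simp only [runExact, stepExact, AExpr.eval]
    refine ⟨?_, fun ρ hρ => ?_, fun ρ hρ => ?_, by rw [g2, g1], fun B hB hmaxB => ?_⟩
    · rw [update_self, l2 _ b1.2, v1, v2]
    · rw [update_of_ne (by omega), l2 _ (by omega), l1 _ hρ]
    · rw [update_of_ne (by omega)]; exact f2 ρ (by omega)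
    · have hB1 : e₁.maxBnd ≤ B := (le_max_left _ _ |>.trans (le_max_right _ _)).trans hmaxB
      have hB2 : e₂.maxBnd ≤ B := (le_max_right _ _ |>.trans (le_max_right _ _)).trans hmaxB
      have r1 := bd1 B hB hB1
      have r2 := bd2 B r1.final hB2
      refine bddRun_append (bddRun_append r1 r2) ?_
      rw [runExact_append]
      refine bddRun_single_regs r2.final ?_ (.add _ _ _ sh) rfl
      rw [l2 _ b1.2, v1, v2]
      exact ((AExpr.add e₁ e₂ sh).eval_le_bnd inp).trans ((le_max_left _ _).trans hmaxB)
  | .mul e₁ e₂, r, st, hfree, hmax => by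
    have b1 := e₁.compile_bounds Wd r; have b2 := e₂.compile_bounds Wd (e₁.compile Wd r).2.2
    have hm1 : e₁.maxBnd < 2 ^ Wd := lt_of_le_of_lt (le_max_left _ _ |>.trans (le_max_right _ _)) hmax
    have hm2 : e₂.maxBnd < 2 ^ Wd := lt_of_le_of_lt (le_max_right _ _ |>.trans (le_max_right _ _)) hmax
    obtain ⟨v1, l1, f1, g1, bd1⟩ := e₁.runExact_compile r st hfree hm1
    set st₁ := runExact inp st (e₁.compile Wd r).1
    obtain ⟨v2, l2, f2, g2, bd2⟩ := e₂.runExact_compile (e₁.compile Wd r).2.2 st₁ f1 hm2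
    set st₂ := runExact inp st₁ (e₂.compile Wd (e₁.compile Wd r).2.2).1
    set x := (e₁.compile Wd r).2.1
    set y := (e₂.compile Wd (e₁.compile Wd r).2.2).2.1
    set r₂ := (e₂.compile Wd (e₁.compile Wd r).2.2).2.2
    have hxv : st₂.regs x = e₁.eval inp := by rw [l2 _ b1.2, v1]
    have hyv : st₂.regs y = e₂.eval inp := v2
    have hxW : st₂.regs x < 2 ^ Wd := by rw [hxv]; exact lt_of_le_of_lt ((e₁.eval_le_bnd inp).trans e₁.bnd_le_maxBnd) hm1
    have hblock : ∀ j, j ≤ 2 * Wd → st₂.regs (r₂ + j) = 0 := fun j _ => f2 _ (by omega)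
    obtain ⟨m1, m2, m3, m4, m5⟩ := runExact_mulInstrs inp Wd (r₀ := r₂) (x := x) (y := y) (by omega) (by omega) st₂ hxW hblock
    simp only [AExpr.compile]
    rw [runExact_append, runExact_append]
    refine ⟨?_, fun ρ hρ => ?_, fun ρ hρ => ?_, by rw [m5, g2, g1], fun B hB hmaxB => ?_⟩
    · rw [m1, hxv, hyv]; rfl
    · rw [m2 ρ (by omega), l2 _ (by omega), l1 _ hρ]
    · rw [m3 ρ (by omega)]; exact f2 ρ (by omega)
    · have hB1 : e₁.maxBnd ≤ B := (le_max_left _ _ |>.trans (le_max_right _ _)).trans hmaxB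
      have hB2 : e₂.maxBnd ≤ B := (le_max_right _ _ |>.trans (le_max_right _ _)).trans hmaxB
      have r1 := bd1 B hB hB1
      have rr2 := bd2 B r1.final hB2
      refine bddRun_append (bddRun_append r1 rr2) ?_
      rw [mulInstrs, runExact_append]
      refine bddRun_mulInstrsUpTo Wd (r₀ := r₂) (x := x) (y := y) (by omega) (by omega) st₂ rr2.final hblock ?_ Wd le_rfl
      rw [hxv, hyv]
      exact ((AExpr.mul e₁ e₂).eval_le_bnd inp).trans ((le_max_left _ _).trans hmaxB)

end Correct

/-! ### Boolean expressions: bookkeeping and correctness -/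

section BExprLemmas

variable (Wd : ℕ)

/-- The allocators only move up; the result flag lies in `[φ, next flag)`. [folklore] -/
theorem BExpr.compile_bounds : ∀ (b : BExpr) (r φ : ℕ),
    r ≤ (b.compile Wd r φ).2.2.1 ∧ φ ≤ (b.compile Wd r φ).2.1 ∧ (b.compile Wd r φ).2.1 < (b.compile Wd r φ).2.2.2
  | .lt e₁ e₂, r, φ => by
    have h1 := e₁.compile_bounds Wd r; have h2 := e₂.compile_bounds Wd (e₁.compile Wd r).2.2
    simp only [BExpr.compile]; omega
  | .not b, r, φ => by have := b.compile_bounds r φ; simp only [BExpr.compile]; omega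
  | .and b₁ b₂, r, φ => by
    have h1 := b₁.compile_bounds r φ; have h2 := b₂.compile_bounds (b₁.compile Wd r φ).2.2.1 (b₁.compile Wd r φ).2.2.2
    simp only [BExpr.compile]; omega
  | .or b₁ b₂, r, φ => by
    have h1 := b₁.compile_bounds r φ; have h2 := b₂.compile_bounds (b₁.compile Wd r φ).2.2.1 (b₁.compile Wd r φ).2.2.2
    simp only [BExpr.compile]; omega

/-- Registers written by a compiled Boolean expression lie in `[r, next register)`. [folklore] -/
theorem BExpr.mem_rdest_compile : ∀ (b : BExpr) (r φ d : ℕ), d ∈ (b.compile Wd r φ).1.filterMap Instr.rdest →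
    r ≤ d ∧ d < (b.compile Wd r φ).2.2.1
  | .lt e₁ e₂, r, φ, d, h => by
    have h1 := e₁.compile_bounds Wd r; have h2 := e₂.compile_bounds Wd (e₁.compile Wd r).2.2
    simp only [BExpr.compile, List.filterMap_append, List.mem_append] at h ⊢
    rcases h with (h | h) | h
    · have := e₁.mem_rdest_compile Wd r d h; omega
    · have := e₂.mem_rdest_compile Wd _ d h; omega
    · simp [Instr.rdest] at h
  | .not b, r, φ, d, h => by
    simp only [BExpr.compile, List.filterMap_append, List.mem_append] at h ⊢
    rcases h with h | h
    · exact b.mem_rdest_compile r φ d h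
    · simp [Instr.rdest] at h
  | .and b₁ b₂, r, φ, d, h => by
    have h1 := b₁.compile_bounds Wd r φ
    simp only [BExpr.compile, List.filterMap_append, List.mem_append] at h ⊢
    rcases h with (h | h) | h
    · have := b₁.mem_rdest_compile r φ d h; have := b₂.compile_bounds Wd (b₁.compile Wd r φ).2.2.1 (b₁.compile Wd r φ).2.2.2; omega
    · have := b₂.mem_rdest_compile _ _ d h; omega
    · simp [Instr.rdest] at h
  | .or b₁ b₂, r, φ, d, h => by
    have h1 := b₁.compile_bounds Wd r φ
    simp only [BExpr.compile, List.filterMap_append, List.mem_append] at h ⊢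
    rcases h with (h | h) | h
    · have := b₁.mem_rdest_compile r φ d h; have := b₂.compile_bounds Wd (b₁.compile Wd r φ).2.2.1 (b₁.compile Wd r φ).2.2.2; omega
    · have := b₂.mem_rdest_compile _ _ d h; omega
    · simp [Instr.rdest] at h

/-- Flags written by a compiled Boolean expression lie in `[φ, next flag)`. [folklore] -/
theorem BExpr.mem_fdest_compile : ∀ (b : BExpr) (r φ f : ℕ), f ∈ (b.compile Wd r φ).1.filterMap Instr.fdest →
    φ ≤ f ∧ f < (b.compile Wd r φ).2.2.2
  | .lt e₁ e₂, r, φ, f, h => by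
    simp only [BExpr.compile, List.filterMap_append, List.mem_append, e₁.filterMap_fdest_compile, e₂.filterMap_fdest_compile,
      List.not_mem_nil, false_or] at h ⊢
    simp [Instr.fdest] at h; omega
  | .not b, r, φ, f, h => by
    have hb := b.compile_bounds Wd r φ
    simp only [BExpr.compile, List.filterMap_append, List.mem_append] at h ⊢
    rcases h with h | h
    · have := b.mem_fdest_compile r φ f h; omega
    · simp [Instr.fdest] at h; omega
  | .and b₁ b₂, r, φ, f, h => by
    have h1 := b₁.compile_bounds Wd r φ; have h2 := b₂.compile_bounds Wd (b₁.compile Wd r φ).2.2.1 (b₁.compile Wd r φ).2.2.2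
    simp only [BExpr.compile, List.filterMap_append, List.mem_append] at h ⊢
    rcases h with (h | h) | h
    · have := b₁.mem_fdest_compile r φ f h; omega
    · have := b₂.mem_fdest_compile _ _ f h; omega
    · simp [Instr.fdest] at h; omega
  | .or b₁ b₂, r, φ, f, h => by
    have h1 := b₁.compile_bounds Wd r φ; have h2 := b₂.compile_bounds Wd (b₁.compile Wd r φ).2.2.1 (b₁.compile Wd r φ).2.2.2
    simp only [BExpr.compile, List.filterMap_append, List.mem_append] at h ⊢
    rcases h with (h | h) | h
    · have := b₁.mem_fdest_compile r φ f h; omega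
    · have := b₂.mem_fdest_compile _ _ f h; omega
    · simp [Instr.fdest] at h; omega

/-- Register destinations of a compiled Boolean expression are pairwise distinct. [folklore] -/
theorem BExpr.nodup_rdest_compile : ∀ (b : BExpr) (r φ : ℕ), ((b.compile Wd r φ).1.filterMap Instr.rdest).Nodup
  | .lt e₁ e₂, r, φ => by
    have h1 := e₁.compile_bounds Wd r
    simp only [BExpr.compile, List.filterMap_append]
    refine List.Nodup.append (List.Nodup.append (e₁.nodup_rdest_compile Wd r) (e₂.nodup_rdest_compile Wd _) ?_) (by simp [Instr.rdest]) ?_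
    · intro d ha hb; have := e₁.mem_rdest_compile Wd r d ha; have := e₂.mem_rdest_compile Wd _ d hb; omega
    · intro d _ hb; simp [Instr.rdest] at hb
  | .not b, r, φ => by
    simp only [BExpr.compile, List.filterMap_append]
    exact List.Nodup.append (b.nodup_rdest_compile r φ) (by simp [Instr.rdest]) (fun d _ hb => by simp [Instr.rdest] at hb)
  | .and b₁ b₂, r, φ => by
    simp only [BExpr.compile, List.filterMap_append]
    refine List.Nodup.append (List.Nodup.append (b₁.nodup_rdest_compile r φ) (b₂.nodup_rdest_compile _ _) ?_) (by simp [Instr.rdest]) ?_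
    · intro d ha hb; have := b₁.mem_rdest_compile Wd r φ d ha; have := b₂.mem_rdest_compile Wd _ _ d hb; omega
    · intro d _ hb; simp [Instr.rdest] at hb
  | .or b₁ b₂, r, φ => by
    simp only [BExpr.compile, List.filterMap_append]
    refine List.Nodup.append (List.Nodup.append (b₁.nodup_rdest_compile r φ) (b₂.nodup_rdest_compile _ _) ?_) (by simp [Instr.rdest]) ?_
    · intro d ha hb; have := b₁.mem_rdest_compile Wd r φ d ha; have := b₂.mem_rdest_compile Wd _ _ d hb; omega
    · intro d _ hb; simp [Instr.rdest] at hb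

/-- Flag destinations of a compiled Boolean expression are pairwise distinct. [folklore] -/
theorem BExpr.nodup_fdest_compile : ∀ (b : BExpr) (r φ : ℕ), ((b.compile Wd r φ).1.filterMap Instr.fdest).Nodup
  | .lt e₁ e₂, r, φ => by
    simp only [BExpr.compile, List.filterMap_append, e₁.filterMap_fdest_compile, e₂.filterMap_fdest_compile]; simp [Instr.fdest]
  | .not b, r, φ => by
    have hb := b.compile_bounds Wd r φ
    simp only [BExpr.compile, List.filterMap_append]
    refine List.Nodup.append (b.nodup_fdest_compile r φ) (by simp [Instr.fdest]) ?_
    intro f ha hb'; have := b.mem_fdest_compile Wd r φ f ha; simp [Instr.fdest] at hb'; omega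
  | .and b₁ b₂, r, φ => by
    have h1 := b₁.compile_bounds Wd r φ; have h2 := b₂.compile_bounds Wd (b₁.compile Wd r φ).2.2.1 (b₁.compile Wd r φ).2.2.2
    simp only [BExpr.compile, List.filterMap_append]
    refine List.Nodup.append (List.Nodup.append (b₁.nodup_fdest_compile r φ) (b₂.nodup_fdest_compile _ _) ?_) (by simp [Instr.fdest]) ?_
    · intro f ha hb; have := b₁.mem_fdest_compile Wd r φ f ha; have := b₂.mem_fdest_compile Wd _ _ f hb; omega
    · intro f ha hb
      simp [Instr.fdest] at hb
      rw [List.mem_append] at ha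
      rcases ha with ha | ha
      · have := b₁.mem_fdest_compile Wd r φ f ha; omega
      · have := b₂.mem_fdest_compile Wd _ _ f ha; omega
  | .or b₁ b₂, r, φ => by
    have h1 := b₁.compile_bounds Wd r φ; have h2 := b₂.compile_bounds Wd (b₁.compile Wd r φ).2.2.1 (b₁.compile Wd r φ).2.2.2
    simp only [BExpr.compile, List.filterMap_append]
    refine List.Nodup.append (List.Nodup.append (b₁.nodup_fdest_compile r φ) (b₂.nodup_fdest_compile _ _) ?_) (by simp [Instr.fdest]) ?_
    · intro f ha hb; have := b₁.mem_fdest_compile Wd r φ f ha; have := b₂.mem_fdest_compile Wd _ _ f hb; omega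
    · intro f ha hb
      simp [Instr.fdest] at hb
      rw [List.mem_append] at ha
      rcases ha with ha | ha
      · have := b₁.mem_fdest_compile Wd r φ f ha; omega
      · have := b₂.mem_fdest_compile Wd _ _ f ha; omega

/-- Side conditions of a Boolean expression: those of its arithmetic sub-expressions. [folklore] -/
def BExpr.OK (Wd kIn : ℕ) : BExpr → Prop
  | .lt e₁ e₂ => e₁.OK Wd kIn ∧ e₂.OK Wd kIn
  | .not b => b.OK Wd kIn
  | .and b₁ b₂ => b₁.OK Wd kIn ∧ b₂.OK Wd kIn
  | .or b₁ b₂ => b₁.OK Wd kIn ∧ b₂.OK Wd kIn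

/-- Shapes of the instructions of a compiled Boolean expression. [folklore] -/
theorem BExpr.shape_compile {kIn R F : ℕ} : ∀ (b : BExpr) (r φ : ℕ), b.OK Wd kIn → (b.compile Wd r φ).2.2.1 ≤ R →
    (b.compile Wd r φ).2.2.2 ≤ F → ∀ ins ∈ (b.compile Wd r φ).1, ins.Shape Wd kIn R F
  | .lt e₁ e₂, r, φ, hok, hR, hF, ins, h => by
    have b1 := e₁.compile_bounds Wd r; have b2 := e₂.compile_bounds Wd (e₁.compile Wd r).2.2
    simp only [BExpr.compile] at hR hF h
    rw [List.mem_append, List.mem_append] at h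
    rcases h with (h | h) | h
    · exact e₁.shape_compile Wd r hok.1 (by omega) ins h
    · exact e₂.shape_compile Wd _ hok.2 (by omega) ins h
    · simp at h; subst h; exact ⟨by omega, by omega, by omega, by omega⟩
  | .not b, r, φ, hok, hR, hF, ins, h => by
    have hb := b.compile_bounds Wd r φ
    simp only [BExpr.compile] at hR hF h
    rw [List.mem_append] at h
    rcases h with h | h
    · exact b.shape_compile r φ hok (by omega) (by omega) ins h
    · simp at h; subst h; exact ⟨by omega, by omega, by omega⟩
  | .and b₁ b₂, r, φ, hok, hR, hF, ins, h => by
    have h1 := b₁.compile_bounds Wd r φ; have h2 := b₂.compile_bounds Wd (b₁.compile Wd r φ).2.2.1 (b₁.compile Wd r φ).2.2.2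
    simp only [BExpr.compile] at hR hF h
    rw [List.mem_append, List.mem_append] at h
    rcases h with (h | h) | h
    · exact b₁.shape_compile r φ hok.1 (by omega) (by omega) ins h
    · exact b₂.shape_compile _ _ hok.2 (by omega) (by omega) ins h
    · simp at h; subst h; exact ⟨by omega, by omega, by omega, by omega, by omega, by omega⟩
  | .or b₁ b₂, r, φ, hok, hR, hF, ins, h => by
    have h1 := b₁.compile_bounds Wd r φ; have h2 := b₂.compile_bounds Wd (b₁.compile Wd r φ).2.2.1 (b₁.compile Wd r φ).2.2.2
    simp only [BExpr.compile] at hR hF h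
    rw [List.mem_append, List.mem_append] at h
    rcases h with (h | h) | h
    · exact b₁.shape_compile r φ hok.1 (by omega) (by omega) ins h
    · exact b₂.shape_compile _ _ hok.2 (by omega) (by omega) ins h
    · simp at h; subst h; exact ⟨by omega, by omega, by omega, by omega, by omega, by omega⟩

/-- `setBit` in a compiled `OK` Boolean expression only with `i < Wd`. [folklore] -/
theorem BExpr.setBit_lt_of_mem_compile {kIn : ℕ} : ∀ (b : BExpr) (r φ : ℕ), b.OK Wd kIn →
    ∀ ins ∈ (b.compile Wd r φ).1, ∀ d i, ins = .setBit d i → i < Wd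
  | .lt e₁ e₂, r, φ, hok, ins, h, d, i, e => by
    simp only [BExpr.compile, List.mem_append] at h
    rcases h with (h | h) | h
    · exact e₁.setBit_lt_of_mem_compile Wd r hok.1 ins h d i e
    · exact e₂.setBit_lt_of_mem_compile Wd _ hok.2 ins h d i e
    · simp at h; subst h; cases e
  | .not b, r, φ, hok, ins, h, d, i, e => by
    simp only [BExpr.compile, List.mem_append] at h
    rcases h with h | h
    · exact b.setBit_lt_of_mem_compile r φ hok ins h d i e
    · simp at h; subst h; cases e
  | .and b₁ b₂, r, φ, hok, ins, h, d, i, e => by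
    simp only [BExpr.compile, List.mem_append] at h
    rcases h with (h | h) | h
    · exact b₁.setBit_lt_of_mem_compile r φ hok.1 ins h d i e
    · exact b₂.setBit_lt_of_mem_compile _ _ hok.2 ins h d i e
    · simp at h; subst h; cases e
  | .or b₁ b₂, r, φ, hok, ins, h, d, i, e => by
    simp only [BExpr.compile, List.mem_append] at h
    rcases h with (h | h) | h
    · exact b₁.setBit_lt_of_mem_compile r φ hok.1 ins h d i e
    · exact b₂.setBit_lt_of_mem_compile _ _ hok.2 ins h d i e
    · simp at h; subst h; cases e

/-- **A compiled `OK` Boolean expression is a well-formed program** (shapes, fresh destinations).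
[folklore] -/
theorem BExpr.progWF_compile {kIn R F : ℕ} (b : BExpr) (r φ : ℕ) (hok : b.OK Wd kIn) (hR : (b.compile Wd r φ).2.2.1 ≤ R)
    (hF : (b.compile Wd r φ).2.2.2 ≤ F) : ProgWF Wd kIn R F (b.compile Wd r φ).1 :=
  ⟨b.shape_compile Wd r φ hok hR hF, b.nodup_rdest_compile Wd r φ, b.nodup_fdest_compile Wd r φ⟩

variable (inp : ℕ)

/-- A single flag-writing step is bounded when the state is. [folklore] -/
theorem bddRun_single_flags {B : ℕ} {st : State} (hst : ∀ ρ, st.regs ρ ≤ B) (ins : Instr)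
    (hins : (stepExact inp st ins).regs = st.regs) : BddRun inp B st [ins] :=
  bddRun_single hst ins fun ρ => by rw [hins]; exact hst ρ

/-- **Correctness of `BExpr.compile`** (exact interpreter): from a state whose registers from `r` on
are clear and whose flags from `φ` on are clear, the compiled program puts `b.eval` into the result
flag; registers below `r` and flags below `φ` are unchanged, the free ones stay clear, and the run is
bounded by any `B` bounding the state and `b.maxBnd`. [folklore] -/
theorem BExpr.runExact_compile : ∀ (b : BExpr) (r φ : ℕ) (st : State), (∀ ρ, r ≤ ρ → st.regs ρ = 0) →
    (∀ f, φ ≤ f → st.flags f = false) → b.maxBnd < 2 ^ Wd →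
    let c := b.compile Wd r φ
    (runExact inp st c.1).flags c.2.1 = b.eval inp ∧
    (∀ ρ, ρ < r → (runExact inp st c.1).regs ρ = st.regs ρ) ∧
    (∀ ρ, c.2.2.1 ≤ ρ → (runExact inp st c.1).regs ρ = 0) ∧
    (∀ f, f < φ → (runExact inp st c.1).flags f = st.flags f) ∧
    (∀ f, c.2.2.2 ≤ f → (runExact inp st c.1).flags f = false) ∧
    (∀ B, (∀ ρ, st.regs ρ ≤ B) → b.maxBnd ≤ B → BddRun inp B st c.1)
  | .lt e₁ e₂, r, φ, st, hfree, hffree, hmax => by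
    have b1 := e₁.compile_bounds Wd r; have b2 := e₂.compile_bounds Wd (e₁.compile Wd r).2.2
    have hm1 : e₁.maxBnd < 2 ^ Wd := lt_of_le_of_lt (le_max_left _ _) hmax
    have hm2 : e₂.maxBnd < 2 ^ Wd := lt_of_le_of_lt (le_max_right _ _) hmax
    obtain ⟨v1, l1, f1, g1, bd1⟩ := e₁.runExact_compile inp Wd r st hfree hm1
    set st₁ := runExact inp st (e₁.compile Wd r).1
    obtain ⟨v2, l2, f2, g2, bd2⟩ := e₂.runExact_compile inp Wd (e₁.compile Wd r).2.2 st₁ f1 hm2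
    set st₂ := runExact inp st₁ (e₂.compile Wd (e₁.compile Wd r).2.2).1
    simp only [BExpr.compile]
    rw [runExact_append, runExact_append]
    simp only [runExact, stepExact, BExpr.eval]
    refine ⟨?_, fun ρ hρ => ?_, fun ρ hρ => f2 ρ hρ, fun f hf => ?_, fun f hf => ?_, fun B hB hmaxB => ?_⟩
    · rw [update_self, l2 _ b1.2, v1, v2]
    · rw [l2 _ (by omega), l1 _ hρ]
    · rw [update_of_ne (by omega), g2, g1]
    · rw [update_of_ne (by omega), g2, g1]; exact hffree f (by omega)
    · have r1 := bd1 B hB ((le_max_left _ _).trans hmaxB)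
      have r2 := bd2 B r1.final ((le_max_right _ _).trans hmaxB)
      refine bddRun_append (bddRun_append r1 r2) ?_
      rw [runExact_append]
      exact bddRun_single_flags inp r2.final _ rfl
  | .not b, r, φ, st, hfree, hffree, hmax => by
    have hb := b.compile_bounds Wd r φ
    obtain ⟨v, l, fr, g, gf, bd⟩ := b.runExact_compile r φ st hfree hffree hmax
    set st₁ := runExact inp st (b.compile Wd r φ).1
    simp only [BExpr.compile]
    rw [runExact_append]
    simp only [runExact, stepExact, BExpr.eval]
    refine ⟨?_, l, fr, fun f hf => ?_, fun f hf => ?_, fun B hB hmaxB => ?_⟩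
    · rw [update_self, v]
    · rw [update_of_ne (by omega), g f hf]
    · rw [update_of_ne (by omega)]; exact gf f (by omega)
    · refine bddRun_append (bd B hB hmaxB) ?_
      exact bddRun_single_flags inp (bd B hB hmaxB).final _ rfl
  | .and b₁ b₂, r, φ, st, hfree, hffree, hmax => by
    have h1 := b₁.compile_bounds Wd r φ; have h2 := b₂.compile_bounds Wd (b₁.compile Wd r φ).2.2.1 (b₁.compile Wd r φ).2.2.2
    have hm1 : b₁.maxBnd < 2 ^ Wd := lt_of_le_of_lt (le_max_left _ _) hmax
    have hm2 : b₂.maxBnd < 2 ^ Wd := lt_of_le_of_lt (le_max_right _ _) hmax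
    obtain ⟨v1, l1, fr1, g1, gf1, bd1⟩ := b₁.runExact_compile r φ st hfree hffree hm1
    set st₁ := runExact inp st (b₁.compile Wd r φ).1
    obtain ⟨v2, l2, fr2, g2, gf2, bd2⟩ := b₂.runExact_compile _ _ st₁ fr1 gf1 hm2
    set st₂ := runExact inp st₁ (b₂.compile Wd (b₁.compile Wd r φ).2.2.1 (b₁.compile Wd r φ).2.2.2).1
    simp only [BExpr.compile]
    rw [runExact_append, runExact_append]
    simp only [runExact, stepExact, BExpr.eval]
    refine ⟨?_, fun ρ hρ => ?_, fr2, fun f hf => ?_, fun f hf => ?_, fun B hB hmaxB => ?_⟩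
    · rw [update_self, g2 _ h1.2.2, v1, v2]
    · rw [l2 _ (by omega), l1 _ hρ]
    · rw [update_of_ne (by omega), g2 _ (by omega), g1 _ hf]
    · rw [update_of_ne (by omega)]; exact gf2 f (by omega)
    · have r1 := bd1 B hB ((le_max_left _ _).trans hmaxB)
      have r2 := bd2 B r1.final ((le_max_right _ _).trans hmaxB)
      refine bddRun_append (bddRun_append r1 r2) ?_
      rw [runExact_append]
      exact bddRun_single_flags inp r2.final _ rfl
  | .or b₁ b₂, r, φ, st, hfree, hffree, hmax => by
    have h1 := b₁.compile_bounds Wd r φ; have h2 := b₂.compile_bounds Wd (b₁.compile Wd r φ).2.2.1 (b₁.compile Wd r φ).2.2.2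
    have hm1 : b₁.maxBnd < 2 ^ Wd := lt_of_le_of_lt (le_max_left _ _) hmax
    have hm2 : b₂.maxBnd < 2 ^ Wd := lt_of_le_of_lt (le_max_right _ _) hmax
    obtain ⟨v1, l1, fr1, g1, gf1, bd1⟩ := b₁.runExact_compile r φ st hfree hffree hm1
    set st₁ := runExact inp st (b₁.compile Wd r φ).1
    obtain ⟨v2, l2, fr2, g2, gf2, bd2⟩ := b₂.runExact_compile _ _ st₁ fr1 gf1 hm2
    set st₂ := runExact inp st₁ (b₂.compile Wd (b₁.compile Wd r φ).2.2.1 (b₁.compile Wd r φ).2.2.2).1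
    simp only [BExpr.compile]
    rw [runExact_append, runExact_append]
    simp only [runExact, stepExact, BExpr.eval]
    refine ⟨?_, fun ρ hρ => ?_, fr2, fun f hf => ?_, fun f hf => ?_, fun B hB hmaxB => ?_⟩
    · rw [update_self, g2 _ h1.2.2, v1, v2]
    · rw [l2 _ (by omega), l1 _ hρ]
    · rw [update_of_ne (by omega), g2 _ (by omega), g1 _ hf]
    · rw [update_of_ne (by omega)]; exact gf2 f (by omega)
    · have r1 := bd1 B hB ((le_max_left _ _).trans hmaxB)
      have r2 := bd2 B r1.final ((le_max_right _ _).trans hmaxB)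
      refine bddRun_append (bddRun_append r1 r2) ?_
      rw [runExact_append]
      exact bddRun_single_flags inp r2.final _ rfl

end BExprLemmas

/-! ### End to end: a Boolean expression as a reversible program -/

section EndToEnd

variable {Wd : ℕ} {L : Layout} {R F T : ℕ}

/-- **A Boolean expression, compiled and laid out, computes its value into its flag wire.** Let the
layout be valid, `b.OK`, the registers/flags used fit below `R`/`F`, every intermediate value fit in
`Wd` bits (`b.maxBnd < 2^{Wd}`), the program fit in `T` scratch blocks, and `w` hold the input on the
input wires and be clear on the layout. Then after `compile L (b.compile Wd 0 0).1` the result flag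
wire holds `b.eval inp`, and the input wires are unchanged. [folklore] -/
theorem BExpr.clEval_compile (hV : L.Valid Wd R F) (b : BExpr) (hok : b.OK Wd L.kIn)
    (hR : (b.compile Wd 0 0).2.2.1 ≤ R) (hF : (b.compile Wd 0 0).2.2.2 ≤ F) (hmax : b.maxBnd < 2 ^ Wd)
    (hT : (b.compile Wd 0 0).1.length ≤ T) {inp : ℕ} {w : ℕ → Bool}
    (hregs : ∀ ρ, ρ < R → ∀ j, j < Wd → w (L.regW (Wd := Wd) ρ j) = false)
    (hflags : ∀ φ, φ < F → w (L.flagW φ) = false) (hscr : ∀ t', t' < T → ∀ o, o < scrSize Wd → w (L.scrW (Wd := Wd) t' o) = false)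
    (hinput : ∀ j, j < L.kIn → w (L.iw j) = inp.testBit j) :
    clEval (SLP.compile L (Wd := Wd) (b.compile Wd 0 0).1) w (L.flagW (b.compile Wd 0 0).2.1) = b.eval inp ∧
      ∀ j, j < L.kIn → clEval (SLP.compile L (Wd := Wd) (b.compile Wd 0 0).1) w (L.iw j) = inp.testBit j := by
  have hb := b.compile_bounds Wd 0 0
  obtain ⟨-, hfl, hin⟩ := SLP.clEval_compile hV (b.progWF_compile Wd 0 0 hok hR hF) hT (inp := inp) hregs hflags hscr hinput
  refine ⟨?_, hin⟩
  rw [hfl _ (by omega)]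
  obtain ⟨v, -, -, -, -, bd⟩ := b.runExact_compile Wd inp 0 0 State.init (fun _ _ => rfl) (fun _ _ => rfl) hmax
  have hW : 0 < 2 ^ Wd := Nat.two_pow_pos Wd
  have hbdd := bd (2 ^ Wd - 1) (fun _ => by show (0 : ℕ) ≤ _; exact Nat.zero_le _) (by omega)
  rw [run_eq_runExact inp Wd _ _ (b.setBit_lt_of_mem_compile Wd 0 0 hok) (fun p₁ p₂ e ρ => by have := hbdd p₁ p₂ e ρ; omega)]
  exact v

end EndToEnd

end SLP

end Literature.Computability.QuantumComplexity
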